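import Summits.CriticalPhenomena.PercolationContinuityZ3.Theorems.PercNearOneGluingNoHeavyLowerTailThreePointLBSwitching
import Literature.Probability.Percolation.SahiSunflowerSeparation
import Literature.Probability.Percolation.StrongHarrisThreePoint
import Mathlib.Tactic.Ring
import Mathlib.Tactic.Linarith
import Mathlib.Tactic.Tauto
import HarnessLib

/-!
# `NoHeavyLowerTail` (stmt-CriticalPhenomena-4575) — the increasing twin `T_inc` of `3PT-LB`:
# identity, the sparse regime `q ≥ t`, and the quantitative lower bound

Support file (prover prim-e3grp-switch-3, E3GRP switching line, strategy 3; `--supports stmt-CriticalPhenomena-4575`).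
No definitions, no named facts, no sorries.

**Object.**  Bernoulli bond percolation `μ = prodBernoulli w` (arbitrary edge weights) on a finite vertex type, three
vertices `a b c`, and the three INCREASING events `N_a = {a ↔ b} ∪ {a ↔ c}`, `N_b = {a ↔ b} ∪ {b ↔ c}`,
`N_c = {a ↔ c} ∪ {b ↔ c}` ("the vertex is joined to at least one of the other two", i.e. the group connection
`lnk[x | {y,z}]`).  Their complements `I_x = {x isolated from the other two}` form a DECREASING sunflower with core
`Q = a|b|c` and petals the 'one pair' cells `a|bc, ac|b, ab|c`; the complement of their union is `T = abc`.
`T_inc := E₃(N_a, N_b, N_c)` (Sahi's third-order functional) is the increasing dual of `3PT-LB = SHK3⁺`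
(harness row `T_inc`; kernel theorem for `n ≤ 5` only; OPEN for all graphs).  It is the base case of the open
increasing E3GRP class `{β, γ, r4, r5, r6}`: `γ = E₃(lnk[ab|cy], lnk[ac|by], lnk[ay|bc])` with `y` isolated is `T_inc`,
and `β = E₃(lnk[a|bcy], lnk[ab|cy], lnk[acy|b])` is `T_inc` on the quotient graph `G/{c = y}`.

**What is proved here** (five cells `t = μ(abc)`, `q = μ(a|b|c)`, `u₃ = μ(ab|c)`, `u₂ = μ(ac|b)`, `u₁ = μ(a|bc)`,
`e₂ = u₃u₂+u₃u₁+u₂u₁`, `e₃ = u₃u₂u₁`, `AG = q t − e₂ ≥ 0` the Aas–Gladkov form):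
* `sahiE3_nonIsol_eq` — `T_inc = (1 + q)·AG − e₃` (the sunflower-complement identity
  `Literature…sahiE3_compl_sunflower_eq` on the decreasing sunflower `I_a, I_b, I_c`, plus the set bookkeeping
  `I_x ∩ I_y = Q`, `I_a ∖ Q = a|bc`, `(I_a ∪ I_b ∪ I_c)ᶜ = abc`).  Compare `3PT-LB = (1 + t)·AG − e₃`
  (`prodBernoulli_sahiE3_pairSep_eq`): the two rows are exchanged by the formal swap `q ↔ t` (core ↔ rest), which is
  not a symmetry of percolation.
* `sahiE3_nonIsol_eq_pairSep_add` — `T_inc = 3PT-LB + (q − t)·AG`.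
* `sahiE3_nonIsol_nonneg_of_le` — **`T_inc ≥ 0` whenever `μ(abc) ≤ μ(a|b|c)`** (the sparse regime), from the tree
  theorems `ThreePointLB.sahiE3_pairSep_nonneg` (3PT-LB) and `prodBernoulli_threePoint_strongHarris` (AG).
* `sahiE3_nonIsol_ge` — for every graph `(1 + t)·T_inc ≥ (q − t)·e₃`, i.e. `T_inc ≥ −e₃·(t − q)⁺/(1 + t)`
  (sharper than `−e₃` from Gladkov's inequality alone); the open regime is `t > q` (dense), where the row is tight
  to first order on the dense star `K_{1,3}` (`T_inc = p³ε⁴(1+p+p²+3pε+ε²)`, `ε = 1 − p`).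
-/

noncomputable section

namespace Summit.CriticalPhenomena.PercolationContinuityZ3.Theorems

open MeasureTheory
open Literature.Probability.LatticeModels
open Literature.Probability.Percolation

namespace TIncRow

variable {V : Type*}

/-- Transitivity bookkeeping for the three pairwise connection events of one configuration. [folklore] -/
theorem trans₃ (ω : BondConfig V) (a b c : V) :
    (ω ∈ openConn a b → ω ∈ openConn b c → ω ∈ openConn a c) ∧
      (ω ∈ openConn a b → ω ∈ openConn a c → ω ∈ openConn b c) ∧
        (ω ∈ openConn a c → ω ∈ openConn b c → ω ∈ openConn a b) :=
  ⟨fun h1 h2 => SimpleGraph.Reachable.trans h1 h2,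
    fun h1 h2 => SimpleGraph.Reachable.trans (SimpleGraph.Reachable.symm h1) h2,
    fun h1 h2 => SimpleGraph.Reachable.trans h1 (SimpleGraph.Reachable.symm h2)⟩

/-- `I_a ∩ I_b = Q`. [folklore] -/
theorem isolA_inter_isolB (a b c : V) :
    ((openConn a b)ᶜ ∩ (openConn a c)ᶜ) ∩ ((openConn a b)ᶜ ∩ (openConn b c)ᶜ) =
      (openConn a b)ᶜ ∩ (openConn a c)ᶜ ∩ (openConn b c)ᶜ := by
  ext ω
  simp only [Set.mem_inter_iff, Set.mem_compl_iff]
  tauto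

/-- `I_a ∩ I_c = Q`. [folklore] -/
theorem isolA_inter_isolC (a b c : V) :
    ((openConn a b)ᶜ ∩ (openConn a c)ᶜ) ∩ ((openConn a c)ᶜ ∩ (openConn b c)ᶜ) =
      (openConn a b)ᶜ ∩ (openConn a c)ᶜ ∩ (openConn b c)ᶜ := by
  ext ω
  simp only [Set.mem_inter_iff, Set.mem_compl_iff]
  tauto

/-- `I_b ∩ I_c = Q`. [folklore] -/
theorem isolB_inter_isolC (a b c : V) :
    ((openConn a b)ᶜ ∩ (openConn b c)ᶜ) ∩ ((openConn a c)ᶜ ∩ (openConn b c)ᶜ) =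
      (openConn a b)ᶜ ∩ (openConn a c)ᶜ ∩ (openConn b c)ᶜ := by
  ext ω
  simp only [Set.mem_inter_iff, Set.mem_compl_iff]
  tauto

/-- `I_a ∖ Q = a|bc`: `({a↔b}ᶜ ∩ {a↔c}ᶜ) ∖ Q = {b↔c} ∩ {a↔b}ᶜ`. [folklore] -/
theorem isolA_diff_core (a b c : V) :
    ((openConn a b)ᶜ ∩ (openConn a c)ᶜ) \ ((openConn a b)ᶜ ∩ (openConn a c)ᶜ ∩ (openConn b c)ᶜ) =
      openConn b c ∩ (openConn a b)ᶜ := by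
  ext ω
  have h := trans₃ ω a b c
  simp only [Set.mem_sdiff, Set.mem_inter_iff, Set.mem_compl_iff]
  tauto

/-- `I_b ∖ Q = ac|b`. [folklore] -/
theorem isolB_diff_core (a b c : V) :
    ((openConn a b)ᶜ ∩ (openConn b c)ᶜ) \ ((openConn a b)ᶜ ∩ (openConn a c)ᶜ ∩ (openConn b c)ᶜ) =
      openConn a c ∩ (openConn a b)ᶜ := by
  ext ω
  have h := trans₃ ω a b c
  simp only [Set.mem_sdiff, Set.mem_inter_iff, Set.mem_compl_iff]
  tauto

/-- `I_c ∖ Q = ab|c`. [folklore] -/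
theorem isolC_diff_core (a b c : V) :
    ((openConn a c)ᶜ ∩ (openConn b c)ᶜ) \ ((openConn a b)ᶜ ∩ (openConn a c)ᶜ ∩ (openConn b c)ᶜ) =
      openConn a b ∩ (openConn a c)ᶜ := by
  ext ω
  have h := trans₃ ω a b c
  simp only [Set.mem_sdiff, Set.mem_inter_iff, Set.mem_compl_iff]
  tauto

/-- `(I_a ∪ I_b ∪ I_c)ᶜ = abc` (written as `{a↔b} ∩ {a↔c}`). [folklore] -/
theorem compl_union_isol (a b c : V) :
    (((openConn a b)ᶜ ∩ (openConn a c)ᶜ) ∪ ((openConn a b)ᶜ ∩ (openConn b c)ᶜ) ∪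
        ((openConn a c)ᶜ ∩ (openConn b c)ᶜ))ᶜ = openConn a b ∩ openConn a c := by
  ext ω
  have h := trans₃ ω a b c
  simp only [Set.mem_compl_iff, Set.mem_union, Set.mem_inter_iff]
  tauto

/-- `N_a = I_aᶜ`: `{a↔b} ∪ {a↔c} = ({a↔b}ᶜ ∩ {a↔c}ᶜ)ᶜ`. [folklore] -/
theorem nonIsol_eq_compl (a b c : V) :
    (openConn a b ∪ openConn a c : Set (BondConfig V)) = ((openConn a b)ᶜ ∩ (openConn a c)ᶜ)ᶜ := by
  rw [Set.compl_inter, compl_compl, compl_compl]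

variable [Finite V]

/-- **`T_inc = (1 + q)·AG − e₃`.**  For `μ = prodBernoulli w` and vertices `a b c`, Sahi's functional on the three
increasing events `N_a = {a↔b} ∪ {a↔c}`, `N_b = {a↔b} ∪ {b↔c}`, `N_c = {a↔c} ∪ {b↔c}` equals
`(1 + μ(a|b|c))·(μ(a|b|c)μ(abc) − [μ(ab|c)μ(ac|b) + μ(ab|c)μ(a|bc) + μ(ac|b)μ(a|bc)]) − μ(ab|c)μ(ac|b)μ(a|bc)`
(cells as in `ThreePointLB.threePointLB_prodBernoulli`).  Sunflower-complement identity on the decreasing sunflower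
`I_a, I_b, I_c` (core `a|b|c`). [folklore] -/
theorem sahiE3_nonIsol_eq (w : Sym2 V → unitInterval) (a b c : V) :
    sahiE3 (prodBernoulli w) (openConn a b ∪ openConn a c) (openConn a b ∪ openConn b c)
        (openConn a c ∪ openConn b c) =
      (1 + (prodBernoulli w).real ((openConn a b)ᶜ ∩ (openConn a c)ᶜ ∩ (openConn b c)ᶜ)) *
          ((prodBernoulli w).real ((openConn a b)ᶜ ∩ (openConn a c)ᶜ ∩ (openConn b c)ᶜ) *
              (prodBernoulli w).real (openConn a b ∩ openConn a c) -
            ((prodBernoulli w).real (openConn a b ∩ (openConn a c)ᶜ) *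
                (prodBernoulli w).real (openConn a c ∩ (openConn a b)ᶜ) +
              (prodBernoulli w).real (openConn a b ∩ (openConn a c)ᶜ) *
                (prodBernoulli w).real (openConn b c ∩ (openConn a b)ᶜ) +
              (prodBernoulli w).real (openConn a c ∩ (openConn a b)ᶜ) *
                (prodBernoulli w).real (openConn b c ∩ (openConn a b)ᶜ))) -
        (prodBernoulli w).real (openConn a b ∩ (openConn a c)ᶜ) *
          (prodBernoulli w).real (openConn a c ∩ (openConn a b)ᶜ) *
          (prodBernoulli w).real (openConn b c ∩ (openConn a b)ᶜ) := by
  classical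
  have hIa : MeasurableSet ((openConn a b)ᶜ ∩ (openConn a c)ᶜ : Set (BondConfig V)) :=
    MeasurableSet.of_discrete
  have hIb : MeasurableSet ((openConn a b)ᶜ ∩ (openConn b c)ᶜ : Set (BondConfig V)) :=
    MeasurableSet.of_discrete
  have hIc : MeasurableSet ((openConn a c)ᶜ ∩ (openConn b c)ᶜ : Set (BondConfig V)) :=
    MeasurableSet.of_discrete
  have key := sahiE3_compl_sunflower_eq (prodBernoulli w) hIa hIb hIc (isolA_inter_isolB a b c)
    (isolA_inter_isolC a b c) (isolB_inter_isolC a b c)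
  rw [isolA_diff_core, isolB_diff_core, isolC_diff_core, compl_union_isol] at key
  have e1 : (openConn a b ∪ openConn a c : Set (BondConfig V)) = ((openConn a b)ᶜ ∩ (openConn a c)ᶜ)ᶜ := by
    rw [Set.compl_inter, compl_compl, compl_compl]
  have e2 : (openConn a b ∪ openConn b c : Set (BondConfig V)) = ((openConn a b)ᶜ ∩ (openConn b c)ᶜ)ᶜ := by
    rw [Set.compl_inter, compl_compl, compl_compl]
  have e3 : (openConn a c ∪ openConn b c : Set (BondConfig V)) = ((openConn a c)ᶜ ∩ (openConn b c)ᶜ)ᶜ := by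
    rw [Set.compl_inter, compl_compl, compl_compl]
  rw [e1, e2, e3, key]
  ring

/-- **`T_inc = 3PT-LB + (q − t)·AG`**: the increasing twin differs from Sahi's functional on the three pairwise
separations by `(μ(a|b|c) − μ(abc))` times the Aas–Gladkov form. [folklore] -/
theorem sahiE3_nonIsol_eq_pairSep_add (w : Sym2 V → unitInterval) (a b c : V) :
    sahiE3 (prodBernoulli w) (openConn a b ∪ openConn a c) (openConn a b ∪ openConn b c)
        (openConn a c ∪ openConn b c) =
      sahiE3 (prodBernoulli w) (openConn a b)ᶜ (openConn a c)ᶜ (openConn b c)ᶜ +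
        ((prodBernoulli w).real ((openConn a b)ᶜ ∩ (openConn a c)ᶜ ∩ (openConn b c)ᶜ) -
            (prodBernoulli w).real (openConn a b ∩ openConn a c)) *
          ((prodBernoulli w).real ((openConn a b)ᶜ ∩ (openConn a c)ᶜ ∩ (openConn b c)ᶜ) *
              (prodBernoulli w).real (openConn a b ∩ openConn a c) -
            ((prodBernoulli w).real (openConn a b ∩ (openConn a c)ᶜ) *
                (prodBernoulli w).real (openConn a c ∩ (openConn a b)ᶜ) +
              (prodBernoulli w).real (openConn a b ∩ (openConn a c)ᶜ) *
                (prodBernoulli w).real (openConn b c ∩ (openConn a b)ᶜ) +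
              (prodBernoulli w).real (openConn a c ∩ (openConn a b)ᶜ) *
                (prodBernoulli w).real (openConn b c ∩ (openConn a b)ᶜ))) := by
  rw [sahiE3_nonIsol_eq, prodBernoulli_sahiE3_pairSep_eq]
  ring

/-- **`T_inc ≥ 0` in the sparse regime.**  For every finite weighted graph and vertices `a b c` with
`μ(abc) ≤ μ(a|b|c)`: `0 ≤ E₃({a↔b} ∪ {a↔c}, {a↔b} ∪ {b↔c}, {a↔c} ∪ {b↔c})` — Sahi/Kahn `C₃` positivity for the
three increasing 'not isolated' events holds whenever all-separated is at least as likely as all-joined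
(from 3PT-LB and the Aas–Gladkov inequality).  The regime `μ(abc) > μ(a|b|c)` is open. [folklore] -/
theorem sahiE3_nonIsol_nonneg_of_le (w : Sym2 V → unitInterval) (a b c : V)
    (hqt : (prodBernoulli w).real (openConn a b ∩ openConn a c) ≤
      (prodBernoulli w).real ((openConn a b)ᶜ ∩ (openConn a c)ᶜ ∩ (openConn b c)ᶜ)) :
    0 ≤ sahiE3 (prodBernoulli w) (openConn a b ∪ openConn a c) (openConn a b ∪ openConn b c)
        (openConn a c ∪ openConn b c) := by
  rw [sahiE3_nonIsol_eq_pairSep_add]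
  have hF := ThreePointLB.sahiE3_pairSep_nonneg w a b c
  have hAG := prodBernoulli_threePoint_strongHarris w a b c
  have h1 : 0 ≤ (prodBernoulli w).real ((openConn a b)ᶜ ∩ (openConn a c)ᶜ ∩ (openConn b c)ᶜ) -
      (prodBernoulli w).real (openConn a b ∩ openConn a c) := by linarith
  have h2 : 0 ≤ (prodBernoulli w).real ((openConn a b)ᶜ ∩ (openConn a c)ᶜ ∩ (openConn b c)ᶜ) *
        (prodBernoulli w).real (openConn a b ∩ openConn a c) -
      ((prodBernoulli w).real (openConn a b ∩ (openConn a c)ᶜ) *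
          (prodBernoulli w).real (openConn a c ∩ (openConn a b)ᶜ) +
        (prodBernoulli w).real (openConn a b ∩ (openConn a c)ᶜ) *
          (prodBernoulli w).real (openConn b c ∩ (openConn a b)ᶜ) +
        (prodBernoulli w).real (openConn a c ∩ (openConn a b)ᶜ) *
          (prodBernoulli w).real (openConn b c ∩ (openConn a b)ᶜ)) := by
    rw [mul_comm]; linarith
  have h3 := mul_nonneg h1 h2
  linarith

/-- **Quantitative lower bound, every graph.**  `(1 + μ(abc))·T_inc ≥ (μ(a|b|c) − μ(abc))·μ(ab|c)μ(ac|b)μ(a|bc)`,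
i.e. `T_inc ≥ −e₃·(t − q)⁺/(1 + t)`: from `T_inc = (1+q)AG − e₃` and 3PT-LB `(1+t)AG ≥ e₃`. [folklore] -/
theorem sahiE3_nonIsol_ge (w : Sym2 V → unitInterval) (a b c : V) :
    ((prodBernoulli w).real ((openConn a b)ᶜ ∩ (openConn a c)ᶜ ∩ (openConn b c)ᶜ) -
          (prodBernoulli w).real (openConn a b ∩ openConn a c)) *
        ((prodBernoulli w).real (openConn a b ∩ (openConn a c)ᶜ) *
          (prodBernoulli w).real (openConn a c ∩ (openConn a b)ᶜ) *
          (prodBernoulli w).real (openConn b c ∩ (openConn a b)ᶜ)) ≤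
      (1 + (prodBernoulli w).real (openConn a b ∩ openConn a c)) *
        sahiE3 (prodBernoulli w) (openConn a b ∪ openConn a c) (openConn a b ∪ openConn b c)
          (openConn a c ∪ openConn b c) := by
  rw [sahiE3_nonIsol_eq]
  have hF := ThreePointLB.threePointLB_prodBernoulli w a b c
  have hAG := prodBernoulli_threePoint_strongHarris w a b c
  set t := (prodBernoulli w).real (openConn a b ∩ openConn a c) with ht
  set q := (prodBernoulli w).real ((openConn a b)ᶜ ∩ (openConn a c)ᶜ ∩ (openConn b c)ᶜ) with hq
  set u₃ := (prodBernoulli w).real (openConn a b ∩ (openConn a c)ᶜ)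
  set u₂ := (prodBernoulli w).real (openConn a c ∩ (openConn a b)ᶜ)
  set u₁ := (prodBernoulli w).real (openConn b c ∩ (openConn a b)ᶜ)
  have tnn : 0 ≤ t := measureReal_nonneg
  have qnn : 0 ≤ q := measureReal_nonneg
  -- AG := q t - e₂ ≥ 0 ; F : (1+t) AG ≥ e₃ ; goal : (q - t) e₃ ≤ (1+t)((1+q)AG - e₃)
  have hAG' : 0 ≤ q * t - (u₃ * u₂ + u₃ * u₁ + u₂ * u₁) := by rw [mul_comm]; linarith
  nlinarith [mul_nonneg qnn hAG', mul_nonneg tnn hAG', mul_nonneg (mul_nonneg qnn tnn) hAG']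

end TIncRow

end Summit.CriticalPhenomena.PercolationContinuityZ3.Theorems

end
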